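import Mathlib
import Summits.ValiantsHypothesis.ValiantsHypothesis.Theorems.FreeSubtorusOrbitDimensionBoundSignLineariseLiftAlgebra
import Summits.ValiantsHypothesis.ValiantsHypothesis.Theorems.FreeSubtorusOrbitDimensionBoundSignCoveringPrelim
import Literature.Computability.AlgebraicComplexity.EquivariantDC
import Literature.Computability.AlgebraicComplexity.DetReprEquivalent
import Literature.Computability.AlgebraicComplexity.LandsbergRessayreNormalForm
import Literature.Computability.AlgebraicComplexity.VonZurGathenSingPermHeight

/-!
# `OrbitDimensionBound` (stmt-ValiantsHypothesis-16133), line `sign_covering`, stub `stub_signLinearise` —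
part 2c: the sign substitutions `γ_s` and the kernel line of `B(0)`

§1: the sign substitutions `γ_s = diag((-1)^{s(inl k) + s(inr l)})`, `s ∈ 𝔽₂^{[n] ⊔ [n]}`, handled as a family `γv`
characterised by its matrices (so that no definition is introduced): `s ↦ γ_s` is additive-to-multiplicative
(`signDiag_add`), the `γ_s` are commuting involutions, `γ_{a s} = γ_s^a`, and for `s` in the sign group `S_Λ` the
element `γ_s` is one of the generators of the `2`-torsion subgroup `T_Λ[2]` (`signDiag_mem_closure`: the relation
`∏ d_k^{Λ_i(inl k)} ∏ e_l^{Λ_i(inr l)} = 1` holds because `(-1)^{Σ Λ_i(x) s(x)} = (-1)^{Λ̄_i · s} = 1`).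
§2: von zur Gathen regularity (`vonzurGathen1987_perm_detRepr_rank_holds`, `isRegularDetRepr_perPoly`) gives a
kernel LINE `ℂ c` of the constant part of any affine determinantal representation of `per_n`, `n ≥ 3`
(`exists_kernel_line`), and every exact lift `B(γ·x) = g · B · h⁻¹` rescales to a normalised one,
`B(γ·x) = g'⁻¹ · B · h'` with `h' c = c` (`exists_normalised_lift`).

No new definitions; helper file for `Theorems/FreeSubtorusOrbitDimensionBoundStubSignLinearise.lean`
(`--supports stmt-ValiantsHypothesis-16133`).  Nothing here moves the crux `OrbitDimensionBound`, the route
`FreeSubtorus` or VP ≠ VNP.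

## References
* [LandsbergRessayre2017] J. M. Landsberg, N. Ressayre, *Permanent v. determinant: an exponential lower bound assuming
  symmetry and a potential path towards Valiant's conjecture*, Differential Geom. Appl. 55 (2017), Def. 1.2, §6.
* [Vonzurgathen1987] J. von zur Gathen, *Permanent and determinant*, Linear Algebra Appl. 96 (1987), Thm. 3.1.
-/

set_option linter.dupNamespace false

namespace Summit.ValiantsHypothesis.ValiantsHypothesis.Theorems.FreeSubtorusOrbitDimensionBound.SignCovering

open Matrix MvPolynomial
open Literature.Computability.AlgebraicComplexity

variable {σ : Type*} [Fintype σ] [DecidableEq σ] {m : ℕ}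

/-! ### §1 Sign substitutions `γ_s` (as a hypothesis-parametrised family) -/

section SignElems

variable {n : ℕ} (γv : ((Fin n ⊕ Fin n) → ZMod 2) → GL (Fin n × Fin n) ℂ)
  (hγv : ∀ s, (γv s : Matrix (Fin n × Fin n) (Fin n × Fin n) ℂ) =
    Matrix.diagonal fun p : Fin n × Fin n =>
      (if s (Sum.inl p.1) = 0 then (1 : ℂ) else -1) * (if s (Sum.inr p.2) = 0 then (1 : ℂ) else -1))

include hγv

omit [Fintype σ] [DecidableEq σ] in
/-- `s ↦ γ_s` is additive-to-multiplicative. [folklore] -/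
theorem signDiag_add (s t : (Fin n ⊕ Fin n) → ZMod 2) : γv (s + t) = γv s * γv t := by
  ext1
  rw [Units.val_mul, hγv, hγv, hγv, Matrix.diagonal_mul_diagonal]
  congr 1
  funext p
  rw [Pi.add_apply, Pi.add_apply, sgn_add, sgn_add]
  ring

omit [Fintype σ] [DecidableEq σ] in
/-- `γ_0 = 1`. [folklore] -/
theorem signDiag_zero : γv 0 = 1 := by
  ext1
  rw [hγv, Units.val_one]
  simp

omit [Fintype σ] [DecidableEq σ] in
/-- The `γ_s` commute. [folklore] -/
theorem signDiag_comm (s t : (Fin n ⊕ Fin n) → ZMod 2) : γv s * γv t = γv t * γv s := by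
  rw [← signDiag_add γv hγv, ← signDiag_add γv hγv, add_comm]

omit [Fintype σ] [DecidableEq σ] in
/-- The `γ_s` are involutions. [folklore] -/
theorem signDiag_sq (s : (Fin n ⊕ Fin n) → ZMod 2) : γv s * γv s = 1 := by
  have hss : s + s = 0 := by
    funext x
    have h2 : ∀ a : ZMod 2, a + a = 0 := by decide
    exact h2 (s x)
  rw [← signDiag_add γv hγv, hss, signDiag_zero γv hγv]

omit [Fintype σ] [DecidableEq σ] in
/-- `γ_{a s} = γ_s ^ a` for `a ∈ 𝔽₂`. [folklore] -/
theorem signDiag_smul (a : ZMod 2) (s : (Fin n ⊕ Fin n) → ZMod 2) : γv (a • s) = γv s ^ a.val := by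
  have h01 : ∀ a : ZMod 2, a = 0 ∨ a = 1 := by decide
  rcases h01 a with rfl | rfl
  · rw [zero_smul, signDiag_zero γv hγv, ZMod.val_zero, pow_zero]
  · rw [one_smul, ZMod.val_one, pow_one]

omit [Fintype σ] [DecidableEq σ] in
/-- For `s` in the sign group `S_Λ`, `γ_s` is one of the generators of `T_Λ[2]`. [cite: LandsbergRessayre2017, §6] -/
theorem signDiag_mem_closure {r : ℕ} (Λ : Fin r → (Fin n ⊕ Fin n) → ℤ) (s : (Fin n ⊕ Fin n) → ZMod 2)
    (hs : ∀ i, (∑ x, ((Λ i x : ℤ) : ZMod 2) * s x) = 0) :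
    γv s ∈ Subgroup.closure {γ : Matrix.GeneralLinearGroup (Fin n × Fin n) ℂ |
      ∃ d e : Fin n → ℂˣ, (∀ i, (∏ k, (d k) ^ (Λ i (Sum.inl k))) * (∏ l, (e l) ^ (Λ i (Sum.inr l))) = 1) ∧
        (∀ k, d k ^ 2 = 1) ∧ (∀ l, e l ^ 2 = 1) ∧
        (γ : Matrix (Fin n × Fin n) (Fin n × Fin n) ℂ) = Matrix.diagonal (fun p => (d p.1 : ℂ) * (e p.2 : ℂ))} := by
  refine Subgroup.subset_closure ?_
  -- the sign character `υ : 𝔽₂ → ℂˣ`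
  have h01 : ∀ a : ZMod 2, a = 0 ∨ a = 1 := by decide
  have haa : ∀ a : ZMod 2, a + a = 0 := by decide
  let υ : ZMod 2 → ℂˣ := fun a => Units.mk0 (if a = 0 then (1 : ℂ) else -1) (sgn_ne_zero a)
  have υ_add : ∀ a b, υ (a + b) = υ a * υ b := fun a b => by
    ext1; simp only [υ, Units.val_mul, Units.val_mk0]; exact sgn_add a b
  have υ_zero : υ 0 = 1 := by ext1; simp [υ]
  have υ_one : υ 1 = -1 := by ext1; simp [υ]
  have υ_sq : ∀ a, υ a ^ 2 = 1 := fun a => by rw [pow_two, ← υ_add, haa, υ_zero]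
  have υ_zpow : ∀ (z : ℤ) (a : ZMod 2), υ a ^ z = υ ((z : ZMod 2) * a) := by
    intro z a
    rcases h01 a with rfl | rfl
    · rw [mul_zero, υ_zero, _root_.one_zpow]
    · rw [mul_one, υ_one]
      rcases Int.even_or_odd z with ⟨k, hk⟩ | ⟨k, hk⟩
      · rw [Even.neg_one_zpow ⟨k, hk⟩, hk, Int.cast_add, haa, υ_zero]
      · rw [Odd.neg_one_zpow ⟨k, hk⟩, hk, Int.cast_add, Int.cast_mul, Int.cast_two, Int.cast_one, two_mul, haa,
          zero_add, υ_one]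
  let υh : Multiplicative (ZMod 2) →* ℂˣ :=
    { toFun := fun a => υ a.toAdd
      map_one' := υ_zero
      map_mul' := fun a b => υ_add _ _ }
  have υ_sum : ∀ (ι : Type) (T : Finset ι) (f : ι → ZMod 2), ∏ i ∈ T, υ (f i) = υ (∑ i ∈ T, f i) := by
    intro ι T f
    have := (map_prod υh (fun i => Multiplicative.ofAdd (f i)) T).symm
    rw [← ofAdd_sum] at this
    exact this
  refine ⟨fun k => υ (s (Sum.inl k)), fun l => υ (s (Sum.inr l)), fun i => ?_, fun k => υ_sq _, fun l => υ_sq _, ?_⟩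
  · simp_rw [υ_zpow]
    rw [υ_sum, υ_sum, ← υ_add, ← Fintype.sum_sum_type (fun x => ((Λ i x : ℤ) : ZMod 2) * s x), hs i, υ_zero]
  · rw [hγv]
    rfl

end SignElems

/-! ### §2 The kernel line of the constant part and normalised lifts -/

section Kernel

/-- **von zur Gathen regularity, as a kernel line**: for an affine determinantal representation `B` of `per_n`
(`n ≥ 3`) the constant part `B(0)` has a one-dimensional kernel, spanned by some `c ≠ 0`.
[cite: Vonzurgathen1987, Thm. 3.1] -/
theorem exists_kernel_line {n m : ℕ} (hn : 3 ≤ n) (B : Matrix (Fin m) (Fin m) (MvPolynomial (Fin n × Fin n) ℂ))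
    (hB : IsAffineDetRepr (perPoly (Fin n) ℂ) B) :
    ∃ c : Fin m → ℂ, c ≠ 0 ∧ constPart B *ᵥ c = 0 ∧ ∀ w, constPart B *ᵥ w = 0 → ∃ β : ℂ, w = β • c := by
  have hreg := (isRegularDetRepr_perPoly vonzurGathen1987_perm_detRepr_rank_holds hn hB).2
  have hm : 0 < m := by
    rcases Nat.eq_zero_or_pos m with h0 | h0
    · exfalso
      subst h0
      have h1 : B.det = 1 := Matrix.det_fin_zero
      have h2 := congrArg constantCoeff (h1.symm.trans hB.2)
      rw [constantCoeff_perPoly ℂ (by omega : 1 ≤ n), map_one] at h2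
      exact one_ne_zero h2
    · exact h0
  set f := (constPart B).mulVecLin with hf
  have hrank : Module.finrank ℂ (LinearMap.range f) = m - 1 := hreg
  have hker : Module.finrank ℂ (LinearMap.ker f) = 1 := by
    have := LinearMap.finrank_range_add_finrank_ker f
    rw [hrank, Module.finrank_fintype_fun_eq_card, Fintype.card_fin] at this
    omega
  obtain ⟨v, hv0, hvspan⟩ := finrank_eq_one_iff'.1 hker
  refine ⟨(v : Fin m → ℂ), fun h => hv0 (Subtype.ext h), ?_, fun w hw => ?_⟩
  · have := v.2
    rw [LinearMap.mem_ker] at this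
    exact this
  · have hw' : w ∈ LinearMap.ker f := by rw [LinearMap.mem_ker]; exact hw
    obtain ⟨β, hβ⟩ := hvspan ⟨w, hw'⟩
    refine ⟨β, ?_⟩
    have := congrArg Subtype.val hβ
    simpa using this.symm

variable (B : Matrix (Fin m) (Fin m) (MvPolynomial σ ℂ))

/-- **Normalising an exact lift.**  If `c ≠ 0` spans the kernel of `B(0)`, every exact lift `(g, h)` of `γ`
(`B(γ·x) = g · B · h⁻¹`) rescales to a normalised lift in the convention `B(γ·x) = g'⁻¹ · B · h'`, `h' c = c`:
`g Λ = Λ h` forces `h⁻¹ c = β c`, and one divides by `β`. [cite: LandsbergRessayre2017, Def. 1.2] -/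
theorem exists_normalised_lift (c : Fin m → ℂ) (hc : c ≠ 0) (hc0 : constPart B *ᵥ c = 0)
    (hspan : ∀ w, constPart B *ᵥ w = 0 → ∃ β : ℂ, w = β • c) {γ : GL σ ℂ}
    (h : ∃ g h : GL (Fin m) ℂ, Matrix.linSubstEntries γ B =
      (g : Matrix (Fin m) (Fin m) ℂ).map C * B * ((h⁻¹ : GL (Fin m) ℂ) : Matrix (Fin m) (Fin m) ℂ).map C) :
    ∃ g h : GL (Fin m) ℂ, Matrix.linSubstEntries γ B =
      ((g⁻¹ : GL (Fin m) ℂ) : Matrix (Fin m) (Fin m) ℂ).map C * B * ((h : GL (Fin m) ℂ) : Matrix (Fin m) (Fin m) ℂ).map C ∧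
      ((h : GL (Fin m) ℂ) : Matrix (Fin m) (Fin m) ℂ) *ᵥ c = c := by
  obtain ⟨g, h, e⟩ := h
  have hst := mul_constPart_eq_of_linSubstEntries_eq e
  -- `h⁻¹ c` lies in the kernel line
  have hk : constPart B *ᵥ (((h⁻¹ : GL (Fin m) ℂ) : Matrix (Fin m) (Fin m) ℂ) *ᵥ c) = 0 := by
    have e2 : constPart B * ((h⁻¹ : GL (Fin m) ℂ) : Matrix (Fin m) (Fin m) ℂ) =
        ((g⁻¹ : GL (Fin m) ℂ) : Matrix (Fin m) (Fin m) ℂ) * constPart B := by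
      calc constPart B * ((h⁻¹ : GL (Fin m) ℂ) : Matrix (Fin m) (Fin m) ℂ)
          = (((g⁻¹ : GL (Fin m) ℂ) : Matrix (Fin m) (Fin m) ℂ) * (g : Matrix (Fin m) (Fin m) ℂ)) *
              constPart B * ((h⁻¹ : GL (Fin m) ℂ) : Matrix (Fin m) (Fin m) ℂ) := by
            rw [← Units.val_mul, inv_mul_cancel, Units.val_one, Matrix.one_mul]
        _ = ((g⁻¹ : GL (Fin m) ℂ) : Matrix (Fin m) (Fin m) ℂ) * (constPart B * (h : Matrix (Fin m) (Fin m) ℂ)) *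
              ((h⁻¹ : GL (Fin m) ℂ) : Matrix (Fin m) (Fin m) ℂ) := by rw [← hst]; simp only [Matrix.mul_assoc]
        _ = ((g⁻¹ : GL (Fin m) ℂ) : Matrix (Fin m) (Fin m) ℂ) * constPart B := by
            rw [Matrix.mul_assoc, Matrix.mul_assoc, ← Units.val_mul, mul_inv_cancel, Units.val_one, Matrix.mul_one]
    rw [Matrix.mulVec_mulVec, e2, ← Matrix.mulVec_mulVec, hc0, Matrix.mulVec_zero]
  obtain ⟨β, hβ⟩ := hspan _ hk
  have hβ0 : β ≠ 0 := by
    intro hb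
    rw [hb, zero_smul] at hβ
    apply hc
    calc c = ((h : Matrix (Fin m) (Fin m) ℂ) * ((h⁻¹ : GL (Fin m) ℂ) : Matrix (Fin m) (Fin m) ℂ)) *ᵥ c := by
          rw [← Units.val_mul, mul_inv_cancel, Units.val_one, Matrix.one_mulVec]
      _ = 0 := by rw [← Matrix.mulVec_mulVec, hβ, Matrix.mulVec_zero]
  -- the scalar correction
  let sβ : GL (Fin m) ℂ := ⟨β⁻¹ • 1, β • 1,
    by rw [smul_mul_smul_comm, inv_mul_cancel₀ hβ0, one_smul, Matrix.mul_one],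
    by rw [smul_mul_smul_comm, mul_inv_cancel₀ hβ0, one_smul, Matrix.mul_one]⟩
  have hsβ : Matrix.linSubstEntries (1 : GL σ ℂ) B = ((sβ⁻¹ : GL (Fin m) ℂ) : Matrix (Fin m) (Fin m) ℂ).map C * B *
      ((sβ : GL (Fin m) ℂ) : Matrix (Fin m) (Fin m) ℂ).map C :=
    (lift_one_iff B).2 (intertwine_smul B (intertwine_one B) β⁻¹)
  have e' : Matrix.linSubstEntries γ B = (((g⁻¹)⁻¹ : GL (Fin m) ℂ) : Matrix (Fin m) (Fin m) ℂ).map C * B *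
      ((h⁻¹ : GL (Fin m) ℂ) : Matrix (Fin m) (Fin m) ℂ).map C := by rw [inv_inv]; exact e
  have := lift_mul B hsβ e'
  rw [one_mul] at this
  refine ⟨sβ * g⁻¹, sβ * h⁻¹, this, ?_⟩
  rw [Units.val_mul, ← Matrix.mulVec_mulVec, hβ, Matrix.mulVec_smul]
  change β • ((β⁻¹ • (1 : Matrix (Fin m) (Fin m) ℂ)) *ᵥ c) = c
  rw [Matrix.smul_mulVec, Matrix.one_mulVec, smul_smul, mul_inv_cancel₀ hβ0, one_smul]

end Kernel

end Summit.ValiantsHypothesis.ValiantsHypothesis.Theorems.FreeSubtorusOrbitDimensionBound.SignCovering
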